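import Literature.Probability.RandomPlanarGeometry.ArcHullDomains
import Literature.Probability.RandomPlanarGeometry.ConformalMapCaratheodoryProofs
import Literature.Topology.PlaneTopology.JordanCurveProofs
import HarnessLib

/-!
# Two-hull Jordan subdomains — stub `stub_rangeIsArc_twoHull` of the line `marked-point-revisit`
(crux `SAWLoopFugacityFlow.SimpleSubseqLimits`, stmt-CriticalPhenomena-4982)

For a chordal uniformizing map `φ : (ℍ; 0, ∞) → (D; a, b)` of a Dobrushin domain, a smooth
plus-hull `J₊` and a disjoint smooth minus-hull `J₋`, `φ(ℍ ∖ (J₊ ∪ J₋))` is the carrier of a hull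
subdomain of `D` (`MarkedDomain.IsHullSubdomain`): the two-hull version of
`exists_isHullSubdomain_of_isArcHull` (`ArcHullDomains`), proved the same way. `IsArcHull.sides`
(Jordan curve theorem, `JordanCurveTheorem_holds`) gives arcs `P₋ : a₋ ↝ b₋`, `P₊ : a₊ ↝ b₊` in `ℍ̄`,
`a₋ < b₋ < 0 < a₊ < b₊` (real points of `J∓` are `≶ 0`), `ℍ ∩ ∂J± = P±(0,1)`, no real point of
`(a±, b±)` in `cl(ℍ ∖ J±)`. The cross-cut `Q = P₋ · [b₋, a₊] · P₊` is an injective path in `ℍ̄`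
with real points `a₋`, `[b₋, a₊] ∋ 0`, `b₊`; its Cayley image followed by the arc of the unit circle
from `C(b₊)` through `1 = C(∞)` to `C(a₋)` (`boundaryArc`, whose points are `1` or `C(y)`,
`y ∉ (a₋, b₊)`: `boundaryArc_eq_one_or`) is a simple loop in the closed disc through `-1 = C(0)`, `1`.
Push it to `cl D` by the Carathéodory homeomorphism `Ψ` (`exists_continuousOn_extension_holds`,
`Ψ ∘ C = φ`). The open bounded set `W = φ(ℍ ∖ (J₊ ∪ J₋))` misses the image loop and has its frontier
on it, so each complementary component `U` (bounded), `V` of the loop lies in `W` or misses it;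
hence `W = U` (so `W` is connected — not assumed) and the loop is `∂W`. Binders are spelled `Jp`,
`Jm`: `J₊` is not a Lean identifier (`₊` is a token, cf. `‖·‖₊`).
-/
noncomputable section

open MeasureTheory Filter Topology Set Metric Complex Function
open Literature.Probability.RandomPlanarGeometry
open UpperHalfPlane (upperHalfPlaneSet isOpen_upperHalfPlaneSet)
open scoped unitInterval Real ComplexConjugate

namespace Summit.CriticalPhenomena.SAWScalingLimit.Theorems.SimpleSubseqLimits.MarkedPointRevisit.ArcRangeTwoHull

open Literature.Topology.PlaneTopology

/-- **Points of the boundary arc of the disc**: every point of `boundaryArc h` (the arc of the unit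
circle from `C(x₁)` through `1` to `C(x₀)`) is `1 = C(∞)` or `C(y)` with `y ∉ (x₀, x₁)`. [folklore] -/
theorem boundaryArc_eq_one_or {x₀ x₁ : ℝ} (h : x₀ < x₁) (s : I) :
    boundaryArc h s = 1 ∨ ∃ y : ℝ, (y ≤ x₀ ∨ x₁ ≤ y) ∧ boundaryArc h s = cayleyFun (y : ℂ) := by
  set m : ℝ := (x₀ + x₁) / 2 with hm
  have hmx₀ : 0 < m - x₀ := by rw [hm]; linarith
  have hmx₁ : m - x₁ < 0 := by rw [hm]; linarith
  set a : ℝ := 1 / (m - x₁) with ha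
  set b : ℝ := 1 / (m - x₀) with hb
  have hba : 0 ≤ b - a := by linarith [one_div_neg.2 hmx₁, one_div_pos.2 hmx₀]
  set u : ℝ := a + (s : ℝ) * (b - a) with hu
  have hua : a ≤ u := le_add_of_nonneg_right (mul_nonneg s.2.1 hba)
  have hub : u ≤ b := by linarith [mul_le_of_le_one_left hba s.2.2]
  show arcFun m u = 1 ∨ ∃ y : ℝ, (y ≤ x₀ ∨ x₁ ≤ y) ∧ arcFun m u = cayleyFun (y : ℂ)
  by_cases hu0 : u = 0
  · left; rw [hu0, arcFun_zero]
  refine Or.inr ⟨m - 1 / u, ?_, arcFun_of_ne_zero m hu0⟩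
  rcases lt_or_gt_of_ne hu0 with hneg | hpos
  · have h1 : 1 / u ≤ 1 / a := one_div_le_one_div_of_neg_of_le hneg hua
    rw [ha, one_div_one_div] at h1; right; linarith
  · have h1 : 1 / b ≤ 1 / u := one_div_le_one_div_of_le hpos hub
    rw [hb, one_div_one_div] at h1; left; linarith

/-- **Stub `stub_rangeIsArc_twoHull` (two-hull Jordan subdomains).** For a chordal uniformizing map
`φ` of the Dobrushin domain `(D; a, b)`, a smooth `+`-hull `Jp` and a disjoint smooth `−`-hull `Jm`,
some hull subdomain `D'` of `D` has carrier `φ(ℍ ∖ (Jp ∪ Jm))` (module docstring: Jordan curve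
theorem for the `Ψ`-image of the loop `C(P₋ · [b₋, a₊] · P₊) · boundaryArc`). [folklore] -/
theorem stub_rangeIsArc_twoHull :
    ∀ (D : DobrushinDomain) (φ : ConformalEquiv upperHalfPlaneSet D.carrier) (Jp Jm : Set ℂ),
      D.IsChordalUniformizing φ → IsArcHull Jp → IsPlusHull Jp → IsArcHull Jm → IsMinusHull Jm →
      Disjoint Jp Jm →
      ∃ D' : DobrushinDomain, D.IsHullSubdomain D' ∧ D'.carrier = φ '' (upperHalfPlaneSet \ (Jp ∪ Jm)) := by
  classical
  intro D φ Jp Jm hφ hJp hplus hJm hminus hdisj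
  obtain ⟨ap, bp, Pp, hltp, hPip, himp, hrealp, hPJp, hfrp, hnotclp, hIccp⟩ :=
    hJp.sides JordanCurveTheorem_holds
  obtain ⟨am, bm, Pm, hltm, hPim, himm, hrealm, hPJm, hfrm, hnotclm, hIccm⟩ :=
    hJm.sides JordanCurveTheorem_holds
  have hap : 0 < ap := hplus.2 ap (hIccp ap le_rfl hltp.le)
  have hbm : bm < 0 := hminus.2 bm (hIccm bm hltm.le le_rfl)
  have hlt : am < bp := by linarith
  set J : Set ℂ := Jp ∪ Jm with hJdef
  have hJc : IsClosed J := hJp.1.isClosed.union hJm.1.isClosed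
  have hJcpt : IsCompact J := hJp.1.isCompact.union hJm.1.isCompact
  have hJim : ∀ z ∈ J, 0 ≤ z.im := fun z hz ↦ mem_closure_upperHalfPlaneSet_iff.1
    (union_subset hJp.1.subset_closure hJm.1.subset_closure hz)
  have h0J : (0 : ℂ) ∉ J := fun h ↦ h.elim hplus.1.2 hminus.1.2
  -- Carathéodory
  obtain ⟨Ψ, hΨc, hΨeq, hbij, -⟩ :=
    JordanDomain.exists_continuousOn_extension_holds D.toJordanDomain (cayley.symm.trans φ)
  have hΨinj : InjOn Ψ (closedBall 0 1) := hbij.injOn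
  have hφΨ : EqOn φ (Ψ ∘ cayleyFun) upperHalfPlaneSet := JordanDomain.eqOn_comp_cayleyFun φ hΨeq
  have ha : Ψ (-1) = D.pt 0 := by
    rw [← cayleyFun_zero]
    simpa using JordanDomain.extension_cayleyFun_eq φ hΨc hΨeq (x := 0) (p := D.pt 0)
      (by simpa using hφ.1)
  have hb : Ψ 1 = D.pt 1 := JordanDomain.extension_one_eq φ hΨc hΨeq hφ.2
  have hcmem : ∀ {z : ℂ}, 0 ≤ z.im → cayleyFun z ∈ closedBall (0 : ℂ) 1 := fun hz ↦
    mem_closedBall_zero_iff.2 (norm_cayleyFun_le_one hz)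
  -- the cross-cut `Q = Pm · [bm, ap] · Pp`
  set seg : Path ((bm : ℝ) : ℂ) ((ap : ℝ) : ℂ) :=
    { toFun := fun s ↦ ((bm + (s : ℝ) * (ap - bm) : ℝ) : ℂ)
      continuous_toFun := by fun_prop
      source' := by simp
      target' := by simp } with hsegdef
  have hseg_apply : ∀ s : I, seg s = ((bm + (s : ℝ) * (ap - bm) : ℝ) : ℂ) := fun s ↦ rfl
  have hsegreal : ∀ w ∈ range seg, ∃ y : ℝ, bm ≤ y ∧ y ≤ ap ∧ w = y := by
    rintro _ ⟨s, rfl⟩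
    exact ⟨_, le_add_of_nonneg_right (mul_nonneg s.2.1 (by linarith)),
      by linarith [mul_le_of_le_one_left (by linarith : 0 ≤ ap - bm) s.2.2], rfl⟩
  have hsegi : Injective seg := fun s t hst ↦ by
    rw [hseg_apply, hseg_apply, ofReal_inj] at hst
    exact Subtype.ext (mul_right_cancel₀ (by linarith : ap - bm ≠ 0) (add_left_cancel hst))
  have hsegsurj : ∀ x : ℝ, bm ≤ x → x ≤ ap → (x : ℂ) ∈ range seg := fun x h1 h2 ↦ by
    refine ⟨⟨(x - bm) / (ap - bm), div_nonneg (by linarith) (by linarith),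
      (div_le_one (by linarith)).2 (by linarith)⟩, ?_⟩
    rw [hseg_apply, ofReal_inj]; simp only
    rw [div_mul_cancel₀ _ (by linarith : ap - bm ≠ 0)]; ring
  set Q : Path ((am : ℝ) : ℂ) ((bp : ℝ) : ℂ) := (Pm.trans seg).trans Pp with hQdef
  have hQrange : range Q = (range Pm ∪ range seg) ∪ range Pp := by
    rw [hQdef, Path.trans_range, Path.trans_range]
  have hQi : Injective Q := by
    refine injective_path_trans' (injective_path_trans' hPim hsegi ?_) hPip ?_
    · rintro w ⟨⟨s, rfl⟩, hw⟩
      obtain ⟨y, hy1, -, hy⟩ := hsegreal _ hw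
      rcases hrealm s (by rw [hy, ofReal_im]) with h | h
      · rw [h, ofReal_inj] at hy; exfalso; linarith
      · exact h
    · rintro w ⟨hw, ⟨s, rfl⟩⟩
      rw [Path.trans_range] at hw
      rcases hw with ⟨t, ht⟩ | hw
      · exact absurd (hPJp ⟨s, rfl⟩) (Set.disjoint_right.1 hdisj (ht ▸ hPJm ⟨t, rfl⟩))
      · obtain ⟨y, -, hy2, hy⟩ := hsegreal _ hw
        rcases hrealp s (by rw [hy, ofReal_im]) with h | h
        · exact h
        · rw [h, ofReal_inj] at hy; exfalso; linarith
  -- real points of `Q`: `am`, `[bm, ap]`, `bp`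
  have hQreal : ∀ w ∈ range Q, 0 ≤ w.im ∧ (w.im = 0 →
      ∃ y : ℝ, w = y ∧ (y = am ∨ (bm ≤ y ∧ y ≤ ap) ∨ y = bp)) := by
    intro w hw
    rw [hQrange] at hw
    rcases hw with (⟨t, rfl⟩ | hw) | ⟨t, rfl⟩
    · refine ⟨himm t, fun hw0 ↦ ?_⟩
      rcases hrealm t hw0 with h | h
      · exact ⟨am, h, Or.inl rfl⟩
      · exact ⟨bm, h, Or.inr (Or.inl ⟨le_rfl, by linarith⟩)⟩
    · obtain ⟨y, hy1, hy2, rfl⟩ := hsegreal _ hw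
      exact ⟨by rw [ofReal_im], fun _ ↦ ⟨y, rfl, Or.inr (Or.inl ⟨hy1, hy2⟩)⟩⟩
    · refine ⟨himp t, fun hw0 ↦ ?_⟩
      rcases hrealp t hw0 with h | h
      · exact ⟨ap, h, Or.inr (Or.inl ⟨by linarith, le_rfl⟩)⟩
      · exact ⟨bp, h, Or.inr (Or.inr rfl)⟩
  have hQim : ∀ s, 0 ≤ (Q s).im := fun s ↦ (hQreal _ (mem_range_self s)).1
  -- the disc loop: `q = C ∘ Q` followed by the boundary arc from `C(bp)` through `1` to `C(am)`
  set q : Path (cayleyFun (am : ℂ)) (cayleyFun (bp : ℂ)) :=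
    { toFun := fun s ↦ cayleyFun (Q s)
      continuous_toFun := continuousOn_cayleyFun.comp_continuous Q.continuous
        fun s ↦ add_I_ne_zero (hQim s)
      source' := by simp only [Q.source]
      target' := by simp only [Q.target] } with hq
  have hq_apply : ∀ s, q s = cayleyFun (Q s) := fun s ↦ rfl
  have hqrange : range q = cayleyFun '' range Q := by rw [← range_comp]; rfl
  have hqinj : Injective q := fun s t h ↦ hQi (cayleyFun_injOn (hQim s) (hQim t) h)
  have hmeet : ∀ w ∈ range q ∩ range (boundaryArc hlt),
      w = cayleyFun (am : ℂ) ∨ w = cayleyFun (bp : ℂ) := by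
    rintro w ⟨⟨s, rfl⟩, ⟨s', hs'⟩⟩
    have him0 : (Q s).im = 0 := by
      by_contra h
      have h1 := (norm_cayleyFun_lt_one_iff (add_I_ne_zero (hQim s))).2
        (lt_of_le_of_ne (hQim s) (Ne.symm h))
      rw [← hq_apply, ← hs', norm_boundaryArc hlt s'] at h1
      exact lt_irrefl _ h1
    obtain ⟨y, hy, hcases⟩ := (hQreal _ (mem_range_self s)).2 him0
    rw [hq_apply, hy] at hs' ⊢
    rcases boundaryArc_eq_one_or hlt s' with h1 | ⟨y', hy', h'⟩
    · exact absurd (hs'.symm.trans h1) (cayleyFun_ne_one _)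
    rw [h'] at hs'
    obtain rfl : y' = y := by exact_mod_cast cayleyFun_injOn (by simp) (by simp) hs'
    rcases hcases with rfl | ⟨h1, h2⟩ | rfl
    exacts [Or.inl rfl, by exfalso; rcases hy' with h' | h' <;> linarith, Or.inr rfl]
  -- the loop `f` in the closed disc
  set L : Path (cayleyFun (am : ℂ)) (cayleyFun (am : ℂ)) := q.trans (boundaryArc hlt) with hL
  set f : ℝ → ℂ := fun s ↦ L.extend (Int.fract s) with hf
  have hfc : Continuous f := path_continuous_extend_fract L
  have hfp : Periodic f 1 := path_periodic_extend_fract L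
  have hfrange : range f = range q ∪ range (boundaryArc hlt) := by
    rw [hf, path_range_extend_fract, hL, Path.trans_range]
  have hfinj : InjOn f (Ico 0 1) := by
    intro s hs t ht hst
    simp only [hf, Int.fract_eq_self.2 hs, Int.fract_eq_self.2 ht] at hst
    exact injOn_path_extend_trans_Ico' hqinj (boundaryArc_injective hlt) hmeet hs ht hst
  have hrangeball : range f ⊆ closedBall (0 : ℂ) 1 := by
    rw [hfrange, union_subset_iff]
    exact ⟨by rintro _ ⟨s, rfl⟩; exact hcmem (hQim s),
      by rintro _ ⟨s, rfl⟩; exact mem_closedBall_zero_iff.2 (norm_boundaryArc hlt s).le⟩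
  have hfball : ∀ s, f s ∈ closedBall (0 : ℂ) 1 := fun s ↦ hrangeball ⟨s, rfl⟩
  have hqf : range q ⊆ range f := hfrange ▸ subset_union_left
  have harcf : range (boundaryArc hlt) ⊆ range f := hfrange ▸ subset_union_right
  have hsegf : ∀ x : ℝ, bm ≤ x → x ≤ ap → cayleyFun (x : ℂ) ∈ range f := fun x h1 h2 ↦ by
    rw [hfrange, hqrange, hQrange]
    exact Or.inl ⟨x, Or.inl (Or.inr (hsegsurj x h1 h2)), rfl⟩
  -- parameters of `-1 = C(0)` and `1 = C(∞)`
  obtain ⟨ta, hfta⟩ : (-1 : ℂ) ∈ range f := by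
    rw [← cayleyFun_zero, ← ofReal_zero]
    exact hsegf 0 hbm.le hap.le
  obtain ⟨tb, hftb⟩ : (1 : ℂ) ∈ range f := harcf (one_mem_range_boundaryArc hlt)
  have htab : ¬ ∃ z : ℤ, tb - ta = z := by
    rintro ⟨z, hz⟩
    have h1 : f tb = f ta := by rw [show tb = ta + z by linarith]; simpa using hfp.int_mul z ta
    rw [hfta, hftb] at h1
    norm_num at h1
  -- the image loop `g = Ψ ∘ f` and the Jordan curve theorem
  set g : ℝ → ℂ := fun s ↦ Ψ (f s) with hg
  have hgc : Continuous g := hΨc.comp_continuous hfc hfball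
  have hgp : Periodic g 1 := fun s ↦ by simp only [hg, hfp s]
  have hginj : InjOn g (Ico 0 1) := fun s hs t ht hst ↦
    hfinj hs ht (hΨinj (hfball s) (hfball t) hst)
  have hgrange : range g = Ψ '' range f := by rw [hg, ← range_comp]; rfl
  obtain ⟨U, V, hUo, hVo, hUc, hVc, -, hunion, hfU, -, -, hVb⟩ :=
    JordanCurveTheorem_holds.of_periodic hgc hgp hginj
  -- the domain `W = φ(ℍ ∖ J)`: open, bounded, nonempty
  set W : Set ℂ := φ '' (upperHalfPlaneSet \ J) with hW
  have hWD : W ⊆ D.carrier := by rintro _ ⟨z, hz, rfl⟩; exact φ.mapsTo hz.1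
  have hWo : IsOpen W := φ.isOpen_image D.isOpen (isOpen_upperHalfPlaneSet.sdiff hJc) sdiff_subset
  have hWb : Bornology.IsBounded W := D.isBounded.subset hWD
  have hWne : W.Nonempty := by
    obtain ⟨R, hR⟩ := hJcpt.isBounded.subset_closedBall 0
    refine ⟨_, ((|R| + 1 : ℝ) : ℂ) * Complex.I, ⟨?_, fun h ↦ ?_⟩, rfl⟩
    · show 0 < ((((|R| + 1 : ℝ) : ℂ)) * Complex.I).im
      rw [mul_I_im, ofReal_re]; positivity
    · have h1 := hR h
      rw [mem_closedBall, dist_zero_right, norm_mul, norm_real, norm_I, mul_one, Real.norm_eq_abs,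
        abs_of_pos (by positivity)] at h1
      linarith [le_abs_self R]
  set S : Set ℂ := cayleyFun '' (upperHalfPlaneSet \ J) with hS
  have hSball : S ⊆ closedBall (0 : ℂ) 1 := by rintro _ ⟨z, hz, rfl⟩; exact hcmem hz.1.le
  have hWΨ : W = Ψ '' S := by rw [hW, hS, image_image]; exact image_congr fun z hz ↦ hφΨ hz.1
  -- (W1) `W` misses the loop
  have hW1 : Disjoint W (range g) := by
    rw [Set.disjoint_left]
    rintro _ ⟨z, hz, rfl⟩ hw
    rw [hgrange] at hw
    obtain ⟨p, hp, hpw⟩ := hw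
    rw [hφΨ hz.1] at hpw
    have hpeq : p = cayleyFun z := hΨinj (hrangeball hp) (hcmem hz.1.le) hpw
    rw [hfrange] at hp
    rcases hp with ⟨s, hs⟩ | ⟨s, hs⟩
    · rw [hq_apply, hpeq] at hs
      have : z ∈ range Q := ⟨s, cayleyFun_injOn (hQim s) (show (0 : ℝ) ≤ z.im from hz.1.le) hs⟩
      rw [hQrange] at this
      rcases this with (hzP | hzs) | hzP
      · exact hz.2 (Or.inr (hPJm hzP))
      · obtain ⟨y, -, -, rfl⟩ := hsegreal _ hzs
        simpa using (show (0 : ℝ) < ((y : ℝ) : ℂ).im from hz.1)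
      · exact hz.2 (Or.inl (hPJp hzP))
    · have hn := norm_boundaryArc hlt s
      rw [hs, hpeq] at hn
      linarith [(norm_cayleyFun_lt_one_iff (add_I_ne_zero hz.1.le)).2 hz.1]
  -- (W2) the frontier of `W` lies on the loop
  obtain ⟨Θ, hΘc, -, hΘΨ, hΨΘ⟩ := JordanDomain.exists_inverse_extension hΨc hbij
  have hW2 : frontier W ⊆ range g := by
    intro w hw
    have hwcl : w ∈ closure W := frontier_subset_closure hw
    have hwW : w ∉ W := fun h ↦ hw.2 (by rwa [hWo.interior_eq])
    have hclD : closure W ⊆ closure D.carrier := closure_mono hWD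
    have hΘW : Θ '' W ⊆ S := by
      rintro _ ⟨w', hw', rfl⟩
      rw [hWΨ] at hw'
      obtain ⟨p, hp, rfl⟩ := hw'
      rwa [hΘΨ p (hSball hp)]
    have hp : Θ w ∈ closure S :=
      closure_mono hΘW ((hΘc.mono hclD).image_closure ⟨w, hwcl, rfl⟩)
    have hwp : w = Ψ (Θ w) := (hΨΘ w (hclD hwcl)).symm
    rw [hwp, hgrange]
    refine mem_image_of_mem Ψ ?_
    rcases closure_image_cayleyFun_subset (sdiff_subset.trans subset_closure) hp with
      ⟨z, hz, hzq⟩ | hp1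
    · rw [← hzq]
      have hzim : 0 ≤ z.im := mem_closure_upperHalfPlaneSet_iff.1 (closure_mono sdiff_subset hz)
      rcases hzim.lt_or_eq with hpos | hzero
      · -- `z ∈ ℍ ∩ ∂J±`: on one of the two arcs
        have hzJ : z ∈ J := by
          by_contra h
          refine hwW ?_
          rw [hwp, ← hzq]
          exact ⟨z, ⟨hpos, h⟩, hφΨ hpos⟩
        have hzfr : ∀ {K : Set ℂ}, IsClosed K → K ⊆ J → z ∈ K → z ∈ frontier K := by
          intro K hKc hKJ hzK
          rw [frontier_eq_closure_inter_closure, hKc.closure_eq]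
          exact ⟨hzK, closure_mono (show upperHalfPlaneSet \ J ⊆ Kᶜ from
            fun u hu hu' ↦ hu.2 (hKJ hu')) hz⟩
        rw [hfrange, hqrange, hQrange]
        rcases hzJ with hzJ | hzJ
        · have : z ∈ upperHalfPlaneSet ∩ frontier Jp := ⟨hpos, hzfr hJp.1.isClosed subset_union_left hzJ⟩
          rw [hfrp] at this
          obtain ⟨s, -, rfl⟩ := this
          exact Or.inl ⟨_, Or.inr ⟨s, rfl⟩, rfl⟩
        · have : z ∈ upperHalfPlaneSet ∩ frontier Jm := ⟨hpos, hzfr hJm.1.isClosed subset_union_right hzJ⟩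
          rw [hfrm] at this
          obtain ⟨s, -, rfl⟩ := this
          exact Or.inl ⟨_, Or.inl (Or.inl ⟨s, rfl⟩), rfl⟩
      · -- `z` real: outside `(am, bm) ∪ (ap, bp)`
        have hzre : z = ((z.re : ℝ) : ℂ) := Complex.ext (by simp) (by simp [← hzero])
        have hz' : ((z.re : ℝ) : ℂ) ∈ closure (upperHalfPlaneSet \ J) := by rwa [← hzre]
        have hcl : ∀ {K : Set ℂ}, K ⊆ J → ((z.re : ℝ) : ℂ) ∈ closure (upperHalfPlaneSet \ K) :=
          fun hKJ ↦ closure_mono (Set.sdiff_subset_sdiff_right hKJ) hz'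
        rw [hzre]
        rcases le_or_gt z.re am with h₁ | h₁
        · exact harcf (cayleyFun_mem_range_boundaryArc hlt (Or.inl h₁))
        rcases lt_or_ge z.re bm with h₂ | h₂
        · exact absurd (hcl subset_union_right) (hnotclm z.re h₁ h₂)
        rcases le_or_gt z.re ap with h₃ | h₃
        · exact hsegf z.re h₂ h₃
        rcases lt_or_ge z.re bp with h₄ | h₄
        · exact absurd (hcl subset_union_left) (hnotclp z.re h₃ h₄)
        · exact harcf (cayleyFun_mem_range_boundaryArc hlt (Or.inr h₄))
    · exact hp1 ▸ harcf (one_mem_range_boundaryArc hlt)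
  -- each side of the loop lies in `W` or misses it; hence `W = U` (so `W` is connected)
  have hclaim : ∀ O : Set ℂ, IsOpen O → IsPreconnected O → O ⊆ (range g)ᶜ →
      O ⊆ W ∨ Disjoint O W := by
    intro O hOo hOc hOg
    have hOW : IsOpen (O \ W) := by
      rw [isOpen_iff_mem_nhds]
      intro u hu
      have hucl : u ∉ closure W := fun hcl ↦
        hOg hu.1 (hW2 ⟨hcl, by rw [hWo.interior_eq]; exact hu.2⟩)
      filter_upwards [hOo.mem_nhds hu.1, isClosed_closure.isOpen_compl.mem_nhds hucl]
        with v hv hv'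
      exact ⟨hv, fun hvW ↦ hv' (subset_closure hvW)⟩
    have hsub : O ⊆ W ∪ (O \ W) := fun u hu ↦ (em (u ∈ W)).imp id fun huW ↦ ⟨hu, huW⟩
    rcases hOc.subset_or_subset hWo hOW disjoint_sdiff_right hsub with h | h
    · exact Or.inl h
    · exact Or.inr (Set.disjoint_left.2 fun u hu huW ↦ (h hu).2 huW)
  have hWU : W = U := by
    have hVW : Disjoint V W := (hclaim V hVo hVc.isPreconnected (hunion ▸ subset_union_right)).resolve_left
      fun h ↦ hVb (hWb.subset h)
    have hWsubU : W ⊆ U := fun w hw ↦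
      (show w ∈ U ∪ V by rw [hunion]; exact hW1.subset_compl_right hw).resolve_right
        fun h ↦ Set.disjoint_left.1 hVW h hw
    rcases hclaim U hUo hUc.isPreconnected (hunion ▸ subset_union_left) with h | h
    · exact hWsubU.antisymm h
    · exact absurd hWne.some_mem (Set.disjoint_left.1 h (hWsubU hWne.some_mem))
  have hfrontW : frontier W = range g := by rw [hWU, hfU]
  -- the Dobrushin domain
  have hfract : 0 < Int.fract (tb - ta) := by
    refine (Int.fract_nonneg (tb - ta)).lt_of_ne fun h ↦ htab ⟨⌊tb - ta⌋, ?_⟩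
    linarith [Int.fract_add_floor (tb - ta)]
  let D' : DobrushinDomain :=
    { carrier := W
      boundary := fun t ↦ g (t + ta)
      isOpen := hWo
      isBounded := hWb
      isConnected := hWU ▸ hUc
      continuous_boundary := hgc.comp (continuous_id.add continuous_const)
      periodic_boundary := fun t ↦ by
        show g (t + 1 + ta) = g (t + ta); rw [add_right_comm]; exact hgp (t + ta)
      injOn_boundary := hgp.injOn_shift hginj ta
      range_boundary := by rw [range_comp_add_right g ta, hfrontW]
      mark := ![0, Int.fract (tb - ta)]
      strictMono_mark := Fin.strictMono_iff_lt_succ.2 fun k ↦ by fin_cases k; simpa using hfract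
      mark_mem := fun k ↦ by
        fin_cases k
        exacts [by simp, ⟨Int.fract_nonneg (tb - ta), Int.fract_lt_one (tb - ta)⟩] }
  have hpt0 : D'.pt 0 = D.pt 0 := by
    show Ψ (f (0 + ta)) = D.pt 0
    rw [zero_add, hfta, ha]
  have hpt1 : D'.pt 1 = D.pt 1 := by
    show Ψ (f (Int.fract (tb - ta) + ta)) = D.pt 1
    have : f (Int.fract (tb - ta) + ta) = f tb := by
      rw [Int.fract, show tb - ta - (⌊tb - ta⌋ : ℝ) + ta = tb - (⌊tb - ta⌋ : ℝ) * 1 by ring]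
      exact hfp.sub_int_mul_eq ⌊tb - ta⌋
    rw [this, hftb, hb]
  -- the removed part `D ∖ W = φ(J ∩ ℍ)` stays away from `a` and `b`
  set T : Set ℂ := Ψ '' (cayleyFun '' J) with hT
  have hTc : IsClosed T := by
    have h1 : IsCompact (cayleyFun '' J) := hJcpt.image_of_continuousOn
      (continuousOn_cayleyFun.mono fun z hz ↦ add_I_ne_zero (hJim z hz))
    have h2 : cayleyFun '' J ⊆ closedBall (0 : ℂ) 1 := by
      rintro _ ⟨z, hz, rfl⟩; exact hcmem (hJim z hz)
    exact (h1.image_of_continuousOn (hΨc.mono h2)).isClosed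
  have hDW : D.carrier \ W ⊆ T := by
    rintro w ⟨hwD, hwW⟩
    obtain ⟨z, hz, rfl⟩ := φ.bijOn.surjOn hwD
    exact hφΨ hz ▸ ⟨_, ⟨z, by_contra fun h ↦ hwW ⟨z, ⟨hz, h⟩, rfl⟩, rfl⟩, rfl⟩
  have hclT : closure (D.carrier \ W) ⊆ T := closure_minimal hDW hTc
  have haT : D.pt 0 ∉ T := by
    rintro ⟨_, ⟨z, hzJ, rfl⟩, hz⟩
    rw [← ha, ← cayleyFun_zero] at hz
    have h1 := hΨinj (hcmem (hJim z hzJ)) (hcmem (by simp)) hz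
    exact h0J (cayleyFun_injOn (hJim z hzJ) (by simp) h1 ▸ hzJ)
  have hbT : D.pt 1 ∉ T := by
    rintro ⟨_, ⟨z, hzJ, rfl⟩, hz⟩
    rw [← hb] at hz
    exact cayleyFun_ne_one _ (hΨinj (hcmem (hJim z hzJ)) (mem_closedBall_zero_iff.2 (by simp)) hz)
  exact ⟨D', ⟨hWD, hpt0, hpt1, fun h ↦ haT (hclT h), fun h ↦ hbT (hclT h)⟩, rfl⟩

end Summit.CriticalPhenomena.SAWScalingLimit.Theorems.SimpleSubseqLimits.MarkedPointRevisit.ArcRangeTwoHull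

end
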